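import Summits.KontsevichZagierPeriods.KontsevichZagierPeriods.Theorems.CubeKernelStep.Negative.NotFibred
import Summits.KontsevichZagierPeriods.KontsevichZagierPeriods.Theorems.CubeKernelStep.Negative.Calibration
import Literature.NumberTheory.Transcendental.KZProductIdeal

/-!
# `CubeKernelStep` (stmt-KontsevichZagierPeriods-17854) — negative side VI: not fibred, even modulo the lower-kernel ideal

cdisprove (refuter) negative lemma for the crux `CubeKernelStep` of route
`KontsevichZagierPeriods/UnfoldedStokes`, in the currency of the crux's idea cards
(relative-injectivity-functional-layer, leray-devissage, kunneth-peel), which consume the step's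
hypothesis `Kc(≤ d)` through the LOWER-KERNEL IDEAL `I_d = ⟨x * [a] : a a continuous closed-cube kernel
element of dimension ≤ d⟩` (Ayoub's type-(b) relators; `I_d ≤ relations` under `Kc(≤ d)` by the landed
ideal property `KZ.mul_mem_relations_left_holds`) and target statements of the shape
`[t] ∈ relations ⊔ I_d` reached by FIBRED chains:

  **`cubeKernelStep_false_fibred_mod_ideal`** — the crux with `KZ.relations` replaced by
  `KZ.fibredRelations ⊔ closure {[r] : dim r ≤ 1} ⊔ closure (lowerKernelGens 1)` is FALSE at `d = 1`
  (`sqRep_not_mem_fibred_mod_ideal`).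

So even with every type-(b) relator of fibre dimension `≤ 1` thrown in, fibred chains over the
parameter do not reach the square kernel element `sqRep`: the move that integrates the parameter out
is irreducibly non-fibred. Mechanism: the slice function of a product `[r] * [a]` is `0` (kernel
factor of dimension `0`), `ℚ`-semialgebraic (`dim r = 0`, the product is one-dimensional) or a.e. `0`
(`dim r ≥ 1`: every rational slab value is `value (r|slab) · value a = 0`, then the tree's
`ae_eq_zero_of_forall_setIntegral_Ioo_rat_eq_zero`) — so along the enlarged subgroup slices are a.e.
`ℚ`-semialgebraic (`AESASlice`), while the slice of `sqRep` is the period function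
`log ((2−s)/(1+s))` (`NotFibred.lean`).

[Kontsevich–Zagier 2001, §1.2, §4.1; Ayoub 2015, §1, Conj. 1.1 (b); Ayoub 2019 (revisited), Thm. 1.11]
-/

noncomputable section

namespace Summit.KontsevichZagierPeriods.UnfoldedStokes.CubeKernelStepNegative

open MeasureTheory Set Filter Topology
open Literature.NumberTheory.Transcendental
open Literature.NumberTheory.Transcendental.KZ
open Literature.ModelTheory.ExponentialFields (IsSemialgebraic)

/-! ### The lower-kernel ideal generators (verbatim the cards' `lowerKernelGens`) -/

/-- Generators of the LOWER-KERNEL IDEAL `I_d`: products `x * [a]` with `a` a continuous closed-cube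
kernel element of dimension `≤ d` (Ayoub's type-(b) relators). Under the step's hypothesis `Kc(≤ d)`
they are relations (`KZ.mul_mem_relations_left_holds`). [cite: Ayoub2015, Conj. 1.1] -/
def lowerKernelGens (d : ℕ) : Set FormalRep :=
  {c | ∃ M : ℕ, M ≤ d ∧ ∃ (a : IntegralRep M) (x : FormalRep),
    a.domain = Set.pi Set.univ (fun _ : Fin M => Set.Icc (0:ℝ) 1) ∧
    ContinuousOn a.integrand a.domain ∧ a.value = 0 ∧ c = x * of a}

/-- Under the layers `≤ d` (relative to `relations`) the ideal generators are relations.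
[cite: Ayoub2015, Conj. 1.1] -/
theorem lowerKernelGens_subset_relations {d : ℕ} (h : ∀ M : ℕ, M ≤ d → KcIn relations M) :
    lowerKernelGens d ⊆ (relations : Set FormalRep) := by
  rintro c ⟨M, hM, a, x, hd, hc, hv, rfl⟩
  exact mul_mem_relations_left_holds (of a) x (h M hM a hd hc hv)

/-! ### The class: almost-everywhere semialgebraic slices -/

/-- `c` has an a.e. `ℚ`-semialgebraic slice function over the parameter `s = z 0`. -/
def AESASlice (c : FormalRep) : Prop :=
  ∃ g : ℝ → ℝ, IsSemialgebraicFunOn ℚ (univ : Set (Fin 1 → ℝ)) (fun z => g (z 0)) ∧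
    sliceEval c =ᵐ[volume] g

/-- Zero slices a.e. are in the class. [folklore] -/
theorem aesaSlice_of_ae_zero {c : FormalRep} (h : sliceEval c =ᵐ[volume] 0) : AESASlice c :=
  ⟨fun _ => 0, (isSemialgebraicFunOn_natCast Literature.ModelTheory.ExponentialFields.isSemialgebraic_univ 0).congr
    fun _ _ => by simp, h.trans (Eventually.of_forall fun _ => rfl)⟩

/-- Exactly semialgebraic slices are in the class. [folklore] -/
theorem aesaSlice_of_eq {c : FormalRep} {g : ℝ → ℝ}
    (hg : IsSemialgebraicFunOn ℚ (univ : Set (Fin 1 → ℝ)) (fun z => g (z 0))) (h : sliceEval c = g) :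
    AESASlice c :=
  ⟨g, hg, h ▸ EventuallyEq.rfl⟩

/-- The class is closed under addition. [folklore] -/
theorem AESASlice.add {c c' : FormalRep} (h : AESASlice c) (h' : AESASlice c') : AESASlice (c + c') := by
  obtain ⟨g, hg, hcg⟩ := h
  obtain ⟨g', hg', hcg'⟩ := h'
  refine ⟨fun s => g s + g' s, IsSemialgebraicFunOn.add_holds hg hg', ?_⟩
  rw [map_add]
  exact hcg.add hcg'

/-- The class is closed under negation. [folklore] -/
theorem AESASlice.neg {c : FormalRep} (h : AESASlice c) : AESASlice (-c) := by
  obtain ⟨g, hg, hcg⟩ := h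
  refine ⟨fun s => -g s, hg.neg, ?_⟩
  rw [map_neg]
  exact hcg.neg

/-- Fibred relations are in the class (tree: slices vanish a.e.). [cite: KontsevichZagier2001, §1.2] -/
theorem aesaSlice_of_mem_fibredRelations {c : FormalRep} (hc : c ∈ fibredRelations) : AESASlice c :=
  aesaSlice_of_ae_zero (sliceEval_ae_eq_zero hc)

/-- Low-dimensional combinations are in the class (`NotFibred.lean`). [folklore] -/
theorem aesaSlice_of_mem_closure_lowDim {c : FormalRep} (hc : c ∈ AddSubgroup.closure lowDim) :
    AESASlice c := by
  obtain ⟨g, hg, h⟩ := exists_semialgebraic_sliceEval_of_mem_closure_lowDim hc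
  exact aesaSlice_of_eq hg h

/-! ### Slices of products with a kernel factor -/

/-- A kernel factor of dimension `0` (a point representation of value `0`) kills the integrand of a
product. [cite: KontsevichZagier2001, §4.1] -/
theorem prod_integrand_eq_zero {n : ℕ} (r : IntegralRep n) (a : IntegralRep 0)
    (ha : a.domain = Set.pi Set.univ (fun _ : Fin 0 => Set.Icc (0:ℝ) 1)) (hv : a.value = 0) :
    (r.prod a).integrand = fun _ => 0 := by
  rw [r.leftResolves.prod_integrand a]
  funext z
  rw [IntegralRep.prodFun_apply, Subsingleton.elim (fun j => z (Fin.natAdd n j)) (fun i => i.elim0),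
    ← value_of_dim_zero a ha, hv, mul_zero]

/-- … hence the slice function of such a product vanishes identically. [folklore] -/
theorem sliceEval_of_prod_dim_zero {n : ℕ} (r : IntegralRep n) (a : IntegralRep 0)
    (ha : a.domain = Set.pi Set.univ (fun _ : Fin 0 => Set.Icc (0:ℝ) 1)) (hv : a.value = 0) :
    sliceEval (of (r.prod a)) = 0 := by
  cases n with
  | zero => exact sliceEval_of_zero (r.prod a)
  | succ k =>
    rw [sliceEval_of]
    funext s
    rw [sliceValue_def, prod_integrand_eq_zero r a ha hv]
    simp

/-- **Slab values of a product with a positive-dimensional left factor**: restricting the parameter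
of `[r] * [a]` to a rational slab gives `value (r|slab) · value a`. [cite: KontsevichZagier2001, §4.1] -/
theorem value_slabRestrict_prod {k : ℕ} (r : IntegralRep (k + 1)) (a : IntegralRep 1) (p q : ℚ) :
    ((r.prod a).slabRestrict p q).value = (r.slabRestrict p q).value * a.value := by
  rw [← IntegralRep.value_prod_of _ _ ((r.slabRestrict p q).leftResolves.isSemialgebraicFunOn_prodFun a)]
  have hd : ((r.prod a).slabRestrict p q).domain = ((r.slabRestrict p q).prod a).domain := by
    ext z
    simp only [IntegralRep.domain_slabRestrict, IntegralRep.prod_domain, IntegralRep.mem_prodDomain,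
      mem_inter_iff, mem_paramSlab]
    have h0 : (Fin.castAdd 1 (0 : Fin (k + 1)) : Fin (k + 1 + 1)) = 0 := Fin.ext rfl
    constructor
    · rintro ⟨⟨h1, h2⟩, h3⟩
      exact ⟨⟨h1, by simpa [h0] using h3⟩, h2⟩
    · rintro ⟨⟨h1, h3⟩, h2⟩
      exact ⟨⟨h1, h2⟩, by simpa [h0] using h3⟩
  have hi : ((r.prod a).slabRestrict p q).integrand = ((r.slabRestrict p q).prod a).integrand := by
    rw [IntegralRep.integrand_slabRestrict, r.leftResolves.prod_integrand a,
      (r.slabRestrict p q).leftResolves.prod_integrand a]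
    rfl
  rw [IntegralRep.value, IntegralRep.value, hd, hi]

/-- **Slices of a product with a one-dimensional kernel factor vanish a.e.** (positive-dimensional
left factor): every rational slab value is `value (r|slab) · 0`. [cite: KontsevichZagier2001, §4.1] -/
theorem sliceValue_prod_ae_zero {k : ℕ} (r : IntegralRep (k + 1)) (a : IntegralRep 1) (hv : a.value = 0) :
    sliceValue (r.prod a) =ᵐ[volume] 0 := by
  refine ae_eq_zero_of_forall_setIntegral_Ioo_rat_eq_zero (integrable_sliceValue _) fun p q => ?_
  rw [← IntegralRep.value_slabRestrict, value_slabRestrict_prod, hv, mul_zero]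

/-- **Every product `[r] * [a]` with a continuous cube kernel factor `a` of dimension `≤ 1` is in the
class.** [cite: Ayoub2015, Conj. 1.1] -/
theorem aesaSlice_of_prod {n M : ℕ} (hM : M ≤ 1) (r : IntegralRep n) (a : IntegralRep M)
    (ha : a.domain = Set.pi Set.univ (fun _ : Fin M => Set.Icc (0:ℝ) 1)) (hv : a.value = 0) :
    AESASlice (of (r.prod a)) := by
  match M, a, hM, ha, hv with
  | 0, a, _, ha, hv =>
    exact aesaSlice_of_ae_zero (Eventually.of_forall fun s => by rw [sliceEval_of_prod_dim_zero r a ha hv])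
  | 1, a, _, _, hv =>
    cases n with
    | zero =>
      -- the product is one-dimensional: a low-dimensional generator
      exact aesaSlice_of_mem_closure_lowDim (AddSubgroup.subset_closure ⟨0 + 1, r.prod a, le_rfl, rfl⟩)
    | succ k =>
      refine aesaSlice_of_ae_zero ?_
      rw [sliceEval_of]
      exact sliceValue_prod_ae_zero r a hv
  | M + 2, _, hM, _, _ => omega

/-- **The lower-kernel ideal generators of fibre dimension `≤ 1` are in the class** (additivity in the
left factor over the free abelian group). [cite: Ayoub2015, Conj. 1.1] -/
theorem aesaSlice_of_mem_lowerKernelGens {c : FormalRep} (hc : c ∈ lowerKernelGens 1) : AESASlice c := by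
  obtain ⟨M, hM, a, x, ha, -, hv, rfl⟩ := hc
  induction x using FreeAbelianGroup.induction_on with
  | zero => rw [zero_mul]; exact aesaSlice_of_ae_zero (by rw [map_zero])
  | of p =>
    obtain ⟨n, r⟩ := p
    have h : FreeAbelianGroup.of (⟨n, r⟩ : Σ k, IntegralRep k) * of a = of (r.prod a) := of_mul_of r a
    rw [h]
    exact aesaSlice_of_prod hM r a ha hv
  | neg p hp =>
    rw [neg_mul]
    exact hp.neg
  | add x y hx hy =>
    rw [add_mul]
    exact hx.add hy

/-- The enlarged subgroup: fibred relations, all of dimension `≤ 1`, and the ideal `I₁`. -/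
def fibredLowIdeal : AddSubgroup FormalRep :=
  fibredRelations ⊔ AddSubgroup.closure lowDim ⊔ AddSubgroup.closure (lowerKernelGens 1)

/-- **THE INVARIANT**: every element of the enlarged subgroup has an a.e. semialgebraic slice
function. [cite: KontsevichZagier2001, §1.2] -/
theorem aesaSlice_of_mem {c : FormalRep} (hc : c ∈ fibredLowIdeal) : AESASlice c := by
  obtain ⟨ab, hab, i, hi, rfl⟩ := AddSubgroup.mem_sup.mp hc
  obtain ⟨a, ha, b, hb, rfl⟩ := AddSubgroup.mem_sup.mp hab
  refine ((aesaSlice_of_mem_fibredRelations ha).add (aesaSlice_of_mem_closure_lowDim hb)).add ?_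
  refine AddSubgroup.closure_induction (p := fun x _ => AESASlice x) (fun x hx => aesaSlice_of_mem_lowerKernelGens hx)
    (aesaSlice_of_ae_zero (by rw [map_zero])) (fun x y _ _ hx hy => hx.add hy) (fun x _ hx => hx.neg) hi

/-! ### The witness is outside -/

/-- **THE SEPARATION.** `[sqRep] ∉ fibredRelations ⊔ closure lowDim ⊔ closure (lowerKernelGens 1)`.
[cite: Ayoub2015, §1] [cite: KontsevichZagier2001, §1.2] -/
theorem sqRep_not_mem_fibred_mod_ideal : of sqRep ∉ fibredLowIdeal := by
  intro hmem
  obtain ⟨g, hg, hae0⟩ := aesaSlice_of_mem hmem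
  rw [sliceEval_of] at hae0
  have hae : ∀ᵐ s ∂(volume : Measure ℝ), s ∈ Ioo (0:ℝ) 1 → periodFun s = g s := by
    filter_upwards [hae0] with s hs hs01
    rw [← sliceValue_sqRep (Ioo_subset_Icc_self hs01)]
    exact hs
  have hgIoo : IsSemialgebraicFunOn ℚ {t : Fin 1 → ℝ | t 0 ∈ Ioo (((-1:ℚ):ℝ)) (2:ℚ)} (fun z => g (z 0)) :=
    hg.mono (subset_univ _) (BallPeeling.isSemialgebraic_Ioo₁ (-1) 2)
  obtain ⟨s₀, hs₀⟩ := exists_finset_continuousAt (a := ((-1:ℚ):ℝ)) (b := ((2:ℚ):ℝ)) (by norm_num) hgIoo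
  have hgV : ∀ e ∈ Ioo (0:ℝ) 1, e ∉ s₀ → g e = periodFun e := fun e he hes =>
    (eq_of_continuousAt_of_ae (hasDerivAt_periodFun he).continuousAt
      (hs₀ e ⟨by have := he.1; push_cast; linarith, by have := he.2; push_cast; linarith⟩ hes) hae he).symm
  exact periodFun_ne_semialgebraic_off_finset s₀ (hg.mono (subset_univ _) isSemialgebraic_openWindow) hgV

/-- Layers `≤ 1` are granted in the enlarged subgroup. [folklore] -/
theorem kcIn_fibredLowIdeal_of_le_one {M : ℕ} (hM : M ≤ 1) : KcIn fibredLowIdeal M :=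
  fun t _ _ _ => AddSubgroup.mem_sup_left (AddSubgroup.mem_sup_right (AddSubgroup.subset_closure ⟨M, t, hM, rfl⟩))

/-- **`CubeKernelStep` FAILS FOR FIBRED CHAINS EVEN MODULO THE LOWER-KERNEL IDEAL `I₁`.** The statement
of the crux with `relations` replaced by `fibredRelations ⊔ closure lowDim ⊔ closure (lowerKernelGens 1)`
is false at `d = 1`: relative (fibred) rules + all of dimension `≤ 1` + all type-(b) relators of fibre
dimension `≤ 1` do not generate the continuous square kernel. [cite: Ayoub2015, §1, Conj. 1.1] -/
theorem cubeKernelStep_false_fibred_mod_ideal : ¬ StepIn fibredLowIdeal := fun h =>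
  sqRep_not_mem_fibred_mod_ideal
    (h 1 le_rfl (fun _ hM => kcIn_fibredLowIdeal_of_le_one hM) sqRep sqRep_domain sqRep_continuousOn
      value_sqRep)

end Summit.KontsevichZagierPeriods.UnfoldedStokes.CubeKernelStepNegative

end
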